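import Summits.BirchSwinnertonDyer.BirchSwinnertonDyer.Theorems.RamifiedSevenEllipticUnitsRubinFormulaZpIffValue
import Summits.BirchSwinnertonDyer.Rank1Residual.X12.O11.RamifiedArchimedeanLawLineZp
import Summits.BirchSwinnertonDyer.Rank1Residual.X12.O11.RouteUModelsA
import Literature.NumberTheory.EllipticCurves.ComplexMultiplicationDeuringGrossencharacter
import Literature.NumberTheory.QuadraticFields.HeegnerCondition
import Summits.BirchSwinnertonDyer.BirchSwinnertonDyer.Theorems.RamifiedSevenEllipticUnitsRelativeValuationOfPackage
import HarnessLib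

set_option linter.dupNamespace false
set_option autoImplicit false

/-!
# K7r value crux `EllipticUnitValueSevenOfGZK` (stmt-BirchSwinnertonDyer-19945), line `rubin-formula-zp` v3:
# the research stub `S_arch` on 𝒞₇ FROM the ∃-free valuation law `S_law` — the base clause (a pinned Hecke
# character on the minimal model `5929e1` of `49a1^{(−11)}`) DISCHARGED modulo Deuring's named fact
# (cell `bsd-cm`, line owner `bsd-cm-k7r-c4` g8; `--supports` 19945; CONDITIONAL records, nothing closed)

HONEST FRAMING. `X12/O11/RamifiedArchimedeanLawLineZp.lean` types the ∃-free law `S_law`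
(`RamifiedCMArchimedeanLawAtZp`), the two classical inputs `S_hecke` / `S_rat`, and proves
«base clause + `S_hecke` + `S_rat` + `S_law` ⟹ `S_arch`» for every `W`, `p`, `D₀`. Here, at `p = 7`,
`D₀ = −11` on the class 𝒞₇:

* §1 the BASE CLAUSE is discharged modulo ONE named PUBLISHED fact: for every frame field `K` of a 𝒞₇ curve
  (`IsFrame W 7 K 𝔭 W' C`: `K` imaginary quadratic with `d_K = −7`), Deuring's theorem
  `Deuring_exists_heckeCharacter_of_maximalCM` (Silverman ATAEC II Thm. 10.5 (b); tree fact, no `_holds`, SIZE XL)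
  applied to the kernel-certified global minimal model `5929e1 = [1, −1, 1, −265, 2104]` of `49a1^{(−11)}`
  (`RouteU.exists_variableChange_c5929e1`, `isGloballyMinimal_c5929e1`; `j = −3375 ∈ maximalCMJInvariants`,
  `IsCMFieldOfJ K (−3375)` from `d_K = −7` and `√d_K ∈ 𝓞_K`) yields a Hecke character `φ₀` of `K` with
  `L(φ₀, s) = L(5929e1, s)` on `re s > 3/2` — `basePin_seven_of_deuring`;
* §2 hence the registered stub shape `stub_archimedeanValuationSevenZp` (`∀ W ∈ 𝒞₇, S_arch W 7 (−11)`) follows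
  from {Deuring fact, `S_hecke` at 7, `S_rat` on 𝒞₇, `S_law` on 𝒞₇} (`archimedeanValuationSevenZp_of_law_of_deuring`),
  and the crux `EllipticUnitValueSevenOfGZK` BY NAME from {Deuring fact, `S_hecke`, `S_rat`, `S_relval`, `S_law`}
  on 𝒞₇ (`valueSevenOfGZK_of_relval_of_law_of_deuring`, through k7r-c4 g7's §3 record
  `RubinFormulaZpIffValue.valueSevenOfGZK_of_relval_of_arch`).

CONDITIONAL kernel records (the gate will list `Deuring_exists_heckeCharacter_of_maximalCM` as a named-fact
hypothesis and the typed inputs as unregistered hypotheses): they credit nothing and close nothing; they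
document that, granted three classical theorems (Deuring — named fact; Hecke continuation and Waldspurger
rationality — typed inputs `S_hecke`, `S_rat`), the research content of the registered stub `S_arch` is the
∃-free law `S_law`, instance-certified 17/17 by the cell's engine. BSD is not proved by any of this.

References: J. Silverman, ATAEC (1994) II Thm. 10.5 (b) [SilvermanATAEC1994]; J. Cremona, Tables (1997)
curve 5929e1 [Cremona1997]; [BKNO] arXiv:2608.06879v1 §1.4 [BurungaleKobayashiNakamuraOta2026]; R. Miller,
LMS J. Comput. Math. 14 (2011) Def. 1.1 [Miller2011LMS]; cell files Lines/rubin-formula-zp.md v3.1,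
RELATIVE-RUBIN-ram-g9.md, PREREG-RRF-ram-g10.md.
-/

noncomputable section

open scoped Classical

open WeierstrassCurve NumberField IsDedekindDomain Field
  Literature.NumberTheory.EllipticCurves
  Literature.NumberTheory.EllipticCurves.Rank1Residual
  Literature.NumberTheory.GaloisRepresentations
  Literature.NumberTheory.DiophantineGeometry
  Summit.BirchSwinnertonDyer.Rank1Residual
  Summit.BirchSwinnertonDyer.Rank1Residual.X12
  Summit.BirchSwinnertonDyer.Rank1Residual.X12.O11

namespace Summit.BirchSwinnertonDyer.BirchSwinnertonDyer.Theorems.RamifiedSevenEllipticUnits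

namespace ArchimedeanLawSeven

/-! ## §1 The base member: a pinned Hecke character on `5929e1` from Deuring's named fact -/

/-- `j(5929e1) = −3375 = −15³` (`c₄ = 12705 = 15·847`, `Δ = −847³`), the `j`-invariant of `49a1`: `5929e1`
has CM by the maximal order of `ℚ(√−7)`. [cite: Cremona1997, Table 1 (curve 5929e1)] -/
theorem j_c5929e1 : (⟨1, -1, 1, -265, 2104⟩ : WeierstrassCurve ℚ).j = -3375 := by
  rw [j_eq_c₄_pow_div]
  norm_num [WeierstrassCurve.c₄, WeierstrassCurve.b₂, WeierstrassCurve.b₄, WeierstrassCurve.Δ,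
    WeierstrassCurve.b₆, WeierstrassCurve.b₈]

/-- `j(5929e1) ∈ maximalCMJInvariants`. [cite: SilvermanATAEC1994, App. A §3 (first table, row D = −7)] -/
theorem j_c5929e1_mem : (⟨1, -1, 1, -265, 2104⟩ : WeierstrassCurve ℚ).j ∈ maximalCMJInvariants := by
  rw [j_c5929e1]
  simp [maximalCMJInvariants]

/-- `5929e1` is a model of `49a1^{(−11)}` in the line's cast convention (`D₀ = −11 : ℤ`).
[cite: Cremona1997, Table 1 (curve 5929e1)] -/
theorem exists_variableChange_c5929e1_int :
    ∃ C₀ : VariableChange ℚ,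
      C₀ • (⟨1, -1, 1, -265, 2104⟩ : WeierstrassCurve ℚ) = cm7.quadraticTwist (((-11 : ℤ)) : ℚ) := by
  simpa using RouteU.exists_variableChange_c5929e1

/-- **The frame field of a 𝒞₇ curve IS the CM field of `5929e1`**: `IsFrame W 7 K 𝔭 W' C` with `W ∈ 𝒞₇` gives
`[K : ℚ] = 2` and `d_K = −7`, and `√d_K ∈ 𝓞_K` (`Quadratic.exists_sq_eq_discr`), so `IsCMFieldOfJ K (−3375)`.
[cite: SilvermanATAEC1994, App. A §3 (first table)] -/
theorem isCMFieldOfJ_c5929e1_of_isFrame {W : WeierstrassCurve ℚ} [W.IsElliptic] [W.IsGloballyMinimal]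
    [Fact (Nat.Prime 7)] (hC : X12.ClassCSeven W) {K : Type} [Field K] [NumberField K]
    {𝔭 : HeightOneSpectrum (𝓞 K)} {W' : WeierstrassCurve ℚ} [W'.IsElliptic] [W'.IsGloballyMinimal]
    {C : VariableChange ℚ} (hF : IsFrame W 7 K 𝔭 W' C) :
    IsCMFieldOfJ K (⟨1, -1, 1, -265, 2104⟩ : WeierstrassCurve ℚ).j := by
  have hK : IsImaginaryQuadratic K := hF.2.2.2.1
  have hdK : NumberField.discr K = -7 := by
    have h := hF.2.2.2.2.1
    rw [hC.2.1] at h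
    exact h
  obtain ⟨-, -, δ, -, hδ⟩ := Literature.NumberTheory.QuadraticFields.Quadratic.exists_sq_eq_discr
    (K := K) hK.1
  refine ⟨hK.1, (δ : K), ?_⟩
  have hcm : cmFieldDiscr ((⟨1, -1, 1, -265, 2104⟩ : WeierstrassCurve ℚ).j) = -7 := by
    rw [j_c5929e1]; norm_num [cmFieldDiscr]
  rw [hcm]
  have h := congrArg (algebraMap (𝓞 K) K) hδ
  rw [hdK, map_pow, map_intCast] at h
  exact h

/-- An imaginary quadratic field has a `ℚ`-automorphism `c ≠ 1` (complex conjugation; `|Aut(K/ℚ)| = 2`).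
[folklore] -/
theorem exists_algEquiv_ne_one {K : Type} [Field K] [NumberField K] (hK : IsImaginaryQuadratic K) :
    ∃ c : K ≃ₐ[ℚ] K, c ≠ 1 := by
  haveI : Algebra.IsQuadraticExtension ℚ K := ⟨hK.1⟩
  have hcard : Nat.card (K ≃ₐ[ℚ] K) = 2 := by rw [IsGalois.card_aut_eq_finrank, hK.1]
  haveI : Finite (K ≃ₐ[ℚ] K) := Nat.finite_of_card_ne_zero (by rw [hcard]; decide)
  haveI : Nontrivial (K ≃ₐ[ℚ] K) := Finite.one_lt_card_iff_nontrivial.mp (by rw [hcard]; decide)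
  exact exists_ne (1 : K ≃ₐ[ℚ] K)

/-- **THE BASE CLAUSE ON 𝒞₇, modulo Deuring's named fact.** For every 𝒞₇ curve `W` and every frame field `K`
of `(W, 7)`, the global minimal model `5929e1` of the base member `49a1^{(−11)}` carries a Hecke character
`φ₀` of `K` with `L(φ₀, s) = L(5929e1, s)` on `re s > 3/2` — clause (v) of
`Deuring_exists_heckeCharacter_of_maximalCM` (Silverman ATAEC II Thm. 10.5 (b)) at `W₀ = 5929e1`,
`j = −3375`, `K` its CM field, `c` complex conjugation. CONDITIONAL on that named fact (published; no `_holds`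
in the tree). [cite: SilvermanATAEC1994, Ch. II Thm. 10.5 (b) (p. 171–172)] [cite: Cremona1997, Table 1 (curve 5929e1)] -/
theorem basePin_seven_of_deuring (hD : Deuring_exists_heckeCharacter_of_maximalCM)
    (W : WeierstrassCurve ℚ) [W.IsElliptic] [W.IsGloballyMinimal] [Fact (Nat.Prime 7)]
    (hC : X12.ClassCSeven W) :
    ∀ (K : Type) [Field K] [NumberField K] (𝔭 : HeightOneSpectrum (𝓞 K))
      (W' : WeierstrassCurve ℚ) [W'.IsElliptic] [W'.IsGloballyMinimal] (C : VariableChange ℚ),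
      IsFrame W 7 K 𝔭 W' C →
        ∃ (W₀ : WeierstrassCurve ℚ) (_ : W₀.IsElliptic) (_ : W₀.IsGloballyMinimal)
          (_ : ∃ C₀ : VariableChange ℚ, C₀ • W₀ = cm7.quadraticTwist (((-11 : ℤ)) : ℚ))
          (φ₀ : HeckeCharacter K), ∀ s : ℂ, 3 / 2 < s.re → heckeLFunction φ₀ s = W₀.LSeries s := by
  intro K _ _ 𝔭 W' _ _ C hF
  obtain ⟨c, hc⟩ := exists_algEquiv_ne_one hF.2.2.2.1
  obtain ⟨ψ, -, -, -, -, hpin⟩ := hD (⟨1, -1, 1, -265, 2104⟩ : WeierstrassCurve ℚ) j_c5929e1_mem K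
    (isCMFieldOfJ_c5929e1_of_isFrame hC hF) c hc
  exact ⟨⟨1, -1, 1, -265, 2104⟩, inferInstance, inferInstance, exists_variableChange_c5929e1_int, ψ, hpin⟩

/-! ## §2 `S_arch` on 𝒞₇ and the crux from the ∃-free law -/

/-- **The registered research stub shape from the law: {Deuring fact, `S_hecke` at 7, `S_rat`|𝒞₇, `S_law`|𝒞₇}
⟹ `∀ W ∈ 𝒞₇, RamifiedCMArchimedeanValuationAtZp W 7 (−11)`** (= the signature of the registered stub
`stub_archimedeanValuationSevenZp` of skeleton v3). CONDITIONAL record: the Deuring fact is a named published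
hypothesis, `S_hecke`/`S_rat` are typed classical inputs, `S_law` is the ∃-free research law; nothing is
closed. [cite: SilvermanATAEC1994, Ch. II Thm. 10.5 (b)] [cite: BurungaleKobayashiNakamuraOta2026, §1.4 (arXiv:2608.06879 p. 8) (shape only)] -/
theorem archimedeanValuationSevenZp_of_law_of_deuring (hD : Deuring_exists_heckeCharacter_of_maximalCM)
    (hhecke : RamifiedCMOddPowerContinuationAtZp 7)
    (hrat : ∀ (W : WeierstrassCurve ℚ) [W.IsElliptic] [W.IsGloballyMinimal] [Fact (Nat.Prime 7)],
      X12.ClassCSeven W → RamifiedCMCentralRatioRationalAtZp W 7 (-11))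
    (hlaw : ∀ (W : WeierstrassCurve ℚ) [W.IsElliptic] [W.IsGloballyMinimal] [Fact (Nat.Prime 7)],
      X12.ClassCSeven W → RamifiedCMArchimedeanLawAtZp W 7 (-11)) :
    ∀ (W : WeierstrassCurve ℚ) [W.IsElliptic] [W.IsGloballyMinimal] [Fact (Nat.Prime 7)],
      X12.ClassCSeven W → RamifiedCMArchimedeanValuationAtZp W 7 (-11) :=
  fun W _ _ _ hC =>
    ramifiedCMArchimedeanValuationAtZp_of_law (basePin_seven_of_deuring hD W hC) hhecke (hrat W hC)
      (hlaw W hC)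

/-- **The crux BY NAME from the law: {Deuring fact, `S_hecke` at 7, `S_rat`|𝒞₇, `S_relval`|𝒞₇, `S_law`|𝒞₇} ⟹
`EllipticUnitValueSevenOfGZK`**, composing `archimedeanValuationSevenZp_of_law_of_deuring` with the v3 record
`RubinFormulaZpIffValue.valueSevenOfGZK_of_relval_of_arch` (k7r-c4 g7, p489138). CONDITIONAL kernel record of
skeleton v3 with `S_arch`'s research content replaced by the ∃-free law; credits nothing.
[cite: Miller2011LMS, Def. 1.1] [cite: SilvermanATAEC1994, Ch. II Thm. 10.5 (b)] -/
theorem valueSevenOfGZK_of_relval_of_law_of_deuring (hD : Deuring_exists_heckeCharacter_of_maximalCM)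
    (hhecke : RamifiedCMOddPowerContinuationAtZp 7)
    (hrat : ∀ (W : WeierstrassCurve ℚ) [W.IsElliptic] [W.IsGloballyMinimal] [Fact (Nat.Prime 7)],
      X12.ClassCSeven W → RamifiedCMCentralRatioRationalAtZp W 7 (-11))
    (hrel : ∀ (W : WeierstrassCurve ℚ) [W.IsElliptic] [W.IsGloballyMinimal] [Fact (Nat.Prime 7)],
      X12.ClassCSeven W → RamifiedCMRelativeValuationAtZp W 7 (-11))
    (hlaw : ∀ (W : WeierstrassCurve ℚ) [W.IsElliptic] [W.IsGloballyMinimal] [Fact (Nat.Prime 7)],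
      X12.ClassCSeven W → RamifiedCMArchimedeanLawAtZp W 7 (-11)) :
    Summit.BirchSwinnertonDyer.BirchSwinnertonDyer.Theses.RamifiedSevenEllipticUnits.EllipticUnitValueSevenOfGZK :=
  RubinFormulaZpIffValue.valueSevenOfGZK_of_relval_of_arch hrel
    (archimedeanValuationSevenZp_of_law_of_deuring hD hhecke hrat hlaw)

/-! ## §3 Skeleton v4 as ONE conditional kernel record (APPENDED, same seat, g8, after the v4
registration 04:32:55Z, skeleton sha16 069d93eb8845d228) -/

/-- **SKELETON v4 OF THE LINE AS A SORRY-FREE CONDITIONAL RECORD: {S_pkg|𝒞₇, S_law|𝒞₇, Deuring's named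
fact, S_hecke at 7, S_rat|𝒞₇} ⟹ the crux `EllipticUnitValueSevenOfGZK` BY NAME.** The two REGISTERED stubs of
skeleton v4 are `stub_rubinPackageSevenZp` (S_pkg = `RamifiedCMRubinPackageAtZp W 7 (−11)`, the jointly
normalised [BKNO] package, p495100) and `stub_archimedeanValuationSevenZp` (S_arch); here S_arch is replaced by
its ∃-free anatomy (§2: Deuring fact + S_hecke + S_rat + S_law) and S_relval by the package
(`RelativeValuationOfPackage.relativeValuationSevenZp_of_package`, p496203), composed through
`valueSevenOfGZK_of_relval_of_law_of_deuring`. CONDITIONAL on five inputs, each typed and labelled in its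
module (S_pkg: PRE existence + LEMMA Ξ + print-local facts + Route-U unit base + the period derivation + the
(R3) reading; S_law: the research law, value form = LAW RRF, conjectural source = PR^×; Deuring: published,
XL; S_hecke/S_rat: published, untyped discharge); credits nothing; closes nothing; BSD is not proved by any
of this. [cite: Miller2011LMS, Def. 1.1] [cite: BurungaleKobayashiNakamuraOta2026, Def. 4.7, Thm. 4.12, Thm. 7.2 and §1.4 (arXiv:2608.06879 pp. 8, 27, 32, 41) (claim; preprint; shape only)]
[cite: SilvermanATAEC1994, Ch. II Thm. 10.5 (b)] -/
theorem valueSevenOfGZK_of_package_of_law_of_deuring (hD : Deuring_exists_heckeCharacter_of_maximalCM)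
    (hhecke : RamifiedCMOddPowerContinuationAtZp 7)
    (hrat : ∀ (W : WeierstrassCurve ℚ) [W.IsElliptic] [W.IsGloballyMinimal] [Fact (Nat.Prime 7)],
      X12.ClassCSeven W → RamifiedCMCentralRatioRationalAtZp W 7 (-11))
    (hpkg : ∀ (W : WeierstrassCurve ℚ) [W.IsElliptic] [W.IsGloballyMinimal] [Fact (Nat.Prime 7)],
      X12.ClassCSeven W → RamifiedCMRubinPackageAtZp W 7 (-11))
    (hlaw : ∀ (W : WeierstrassCurve ℚ) [W.IsElliptic] [W.IsGloballyMinimal] [Fact (Nat.Prime 7)],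
      X12.ClassCSeven W → RamifiedCMArchimedeanLawAtZp W 7 (-11)) :
    Summit.BirchSwinnertonDyer.BirchSwinnertonDyer.Theses.RamifiedSevenEllipticUnits.EllipticUnitValueSevenOfGZK :=
  valueSevenOfGZK_of_relval_of_law_of_deuring hD hhecke hrat
    (RelativeValuationOfPackage.relativeValuationSevenZp_of_package hpkg) hlaw

end ArchimedeanLawSeven

end Summit.BirchSwinnertonDyer.BirchSwinnertonDyer.Theorems.RamifiedSevenEllipticUnits

end
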